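import Literature.AlgebraicGeometry.Frobenioids.Thm36SubProofs2
import Literature.AlgebraicGeometry.Frobenioids.ModelFrobenioidAutAction
import HarnessLib

/-!
# Frobenioids II, Theorem 3.6 (iv), first sentence, for `C^ℝ := C^rlf` — PROVED (slot `ivFactors_R`)

Mochizuki, *The geometry of Frobenioids II: poly-Frobenioids*, Kyushu J. Math. **62** (2008) 401–460,
§3, Theorem 3.6 (iv), kurims text p. 37 [cite: MochizukiFrdII2008, Thm 3.6 (iv) p.37]:

> "(iv) Let `A ∈ Ob(F)`; `A_D := Base(A) ∈ Ob(D)`. Write `A₀ ∈ Ob(D₀)` for the image of `A_D` in `D₀`.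
> Then the natural action of `Aut_F(A)` on `O^▷(A), O^×(A)` factors through `Aut_{D₀}(A₀)`."

(proof, p. 39: "follow[s] immediately from the definitions").  This file closes the slot
`ArchFrd.Thm36Sub.ivFactors_R` of the sub-DAG statements file `Thm36Sub.lean` (abc-iut cell, layer L1,
row M13; seat abc-iut-w4-d074), i.e. the `Λ = ℝ` conjunct of the instance statement `Thm36iv_factors`
read over THE realification `C^ℝ := C^rlf` of the archimedean Frobenioid `C` of Example 3.3 ([FrdI]
Prop. 5.3; `ArchFrd.rlfCat π` with structure functor `ArchFrd.rlfStr π`).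

PROOF.  `C^rlf` is the MODEL Frobenioid ([FrdI] Thm. 5.2 (i)) of the datum `(Φ^rlf, ℝ · Φ^birat)`; for a
model Frobenioid the conjugate `α⁻¹ ∘ f ∘ α` of a base-identity linear endomorphism
`f = (1, id, Div(f), u_f) ∈ O^▷(A)` by an automorphism `α` is `(1, id, Base(α⁻¹)^* Div(f), Base(α⁻¹)^* u_f)`
(`ModelFrobenioid.div_conj'`, `ModelFrobenioid.unit_conj'`, file `ModelFrobenioidAutAction.lean`).  For the
archimedean Frobenioid the divisor monoid `Φ = Φ₀|_D` is the constant monoid `ℝ_{≥0}` (Ex. 3.3 (i)), so the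
pull-back maps of `Φ^rlf` and of its groupification are identities (`Thm36Sub.rlfFunctor_Φ_map_apply`,
`Thm36Sub.pullGp_rlf_eq`, seat abc-iut-w4-d074), and so are those of the sub-functor `ℝ · Φ^birat ⊆ (Φ^rlf)^gp`.
Hence in `C^rlf` EVERY automorphism of `A` acts trivially on `O^▷(A)` and on `O^×(A)`
(`rlf_conj_eq_self`, `rlf_autAction_trivial`) — in particular the action factors through `Aut_{D₀}(A₀)`
(`ivFactors_R_holds`).  (Recall also (v) (c): `O^×(A) = {1}` in `C^ℝ`, `Thm36Sub.rlf_unitsSubgroup_eq_bot`.)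

Proof-only companion (no `def`); no statement of the paper is re-typed or strengthened as a statement;
typed ≠ proved elsewhere; nothing here bears on [IUTchIII] Cor. 3.12.  Seat abc-iut-L1-d5 (gen 3).
-/

noncomputable section

namespace Literature.AlgebraicGeometry.Frobenioids

open CategoryTheory Opposite Literature.AnabelianGeometry.EtaleTheta
open scoped NNReal

universe v u

namespace ArchFrd

namespace Thm36Sub

variable {D : Type u} [Category.{v} D] (π : D ⥤ D0)

/-- **In `C^ℝ = C^rlf`, conjugation by any automorphism fixes every base-identity linear endomorphism**:
`α⁻¹ ∘ f ∘ α = f` for `α ∈ Aut(A)`, `f ∈ O^▷(A)` — the model-Frobenioid formula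
`α⁻¹ ∘ f ∘ α = (1, id, Base(α⁻¹)^* Div(f), Base(α⁻¹)^* u_f)` together with "the pull-backs of `Φ^rlf`
(`Φ = ℝ_{≥0}` constant) are identities". [cite: MochizukiFrdII2008, Thm 3.6 (iv) p.37] -/
theorem rlf_conj_eq_self {A : rlfCat π} (α : A ≅ A) (f : A ⟶ A)
    (hf : f ∈ PreFrobenioid.endSubmonoid (rlfStr π) A) : α.inv ≫ f ≫ α.hom = f := by
  have hfb : ModelFrobenioid.baseMap f = 𝟙 A.base := hf.1
  have hfd : ModelFrobenioid.degFr f = 1 := hf.2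
  refine ModelFrobenioid.hom_ext ?_ ?_ ?_ ?_
  · rw [ModelFrobenioid.degFr_conj' α hfd, hfd]
  · rw [ModelFrobenioid.baseMap_conj' α hfb, hfb]
  · rw [ModelFrobenioid.div_conj' α hfb hfd]
    exact rlfFunctor_Φ_map_apply π _ _
  · rw [ModelFrobenioid.unit_conj' α hfb hfd]
    apply Subtype.ext
    exact pullGp_rlf_eq π _ _

/-- **The action of `Aut_{C^ℝ}(A)` on `O^▷(A)` and on `O^×(A)` is trivial** (both clauses, in the
conjugation convention `α.symm ≪≫ u ≪≫ α` of the schema `Thm36iv_factors`).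
[cite: MochizukiFrdII2008, Thm 3.6 (iv) p.37] -/
theorem rlf_autAction_trivial (A : rlfCat π) (α : Aut A) :
    (∀ f ∈ PreFrobenioid.endSubmonoid (rlfStr π) A, α.inv ≫ f ≫ α.hom = f) ∧
      ∀ u ∈ PreFrobenioid.unitsSubgroup (rlfStr π) A, α.symm ≪≫ u ≪≫ α = u := by
  refine ⟨fun f hf => rlf_conj_eq_self π α f hf, fun u hu => ?_⟩
  apply Iso.ext
  change α.inv ≫ u.hom ≫ α.hom = u.hom
  exact rlf_conj_eq_self π α u.hom ⟨hu.1, hu.2⟩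

/-- **Theorem 3.6 (iv), first sentence, for `C^ℝ := C^rlf`** (slot `Thm36Sub.ivFactors_R`, PROVED): the
natural action of `Aut_F(A)` on `O^▷(A), O^×(A)` factors through `Aut_{D₀}(A₀)` — automorphisms with the
same image in `Aut_{D₀}(A₀)` act identically (indeed every automorphism acts trivially,
`rlf_autAction_trivial`). [cite: MochizukiFrdII2008, Thm 3.6 (iv) p.37] -/
theorem ivFactors_R_holds : ivFactors_R π := by
  intro A α α' _
  refine ⟨fun f hf => ?_, fun u hu => ?_⟩
  · rw [rlf_conj_eq_self π α f hf, rlf_conj_eq_self π α' f hf]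
  · rw [(rlf_autAction_trivial π A α).2 u hu, (rlf_autAction_trivial π A α').2 u hu]

end Thm36Sub

end ArchFrd

end Literature.AlgebraicGeometry.Frobenioids

end
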